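import Summits.QuantumFields.BalabanUV.Beta.CompositeCorrectorFormsGeneric

/-!
# `BalabanUV.Beta.CompositeCorrectorCovarianceGeneric` — binder row D1 ∕ (C1): **THE SCHEME-GENERIC COMPOSITE CORRECTORS ARE COARSE-TRANSLATION COVARIANT AND DO NOT
# TOUCH INTRA-BLOCK COORDINATES** — an2 g24's `CompositeCorrectorCovariance` (`corrPhi_apply_of_blk_eq ∕ corrPsi_apply_of_blk_eq`, `compLinAvgAt_shift ∕ compDefectAt_shift ∕
# corrPhi_shift ∕ corrPsi_shift`) re-proved for ANY one-step averaging family from two one-step covariance letters (§1–§2), and INSTANTIATED at the (0.4)-SYMMETRISED scheme (§3–§4):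
# one-level letters `contourSum_shift' ∕ symLinAvgAt_shift' ∕ avSym_shift ∕ lamSym_shift`, then **`compLinAvgSymAt_shift`**, **`compDefectSymAt_shift`**, **`corrPhiSym_shift`**,
# **`corrPsiSym_shift`**, `corrPhiSym_apply_of_blk_eq ∕ corrPsiSym_apply_of_blk_eq` — K-U3d-sym's SIXTH form-level brick: the covariance input of the corrector kernel's `Spr`
# (K-U3d's `CompositeCorrectorKernelSpr` consumes exactly `corrPsi_shift ∕ corrPhi_shift`) (row OWNER an2 gen 89; sequel of PART 124–128)

HONEST FRAMING (cell charter, verbatim): «discharging BetaPertH makes Balaban's UV stability UNCONDITIONAL — a real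
constructive-QFT result; it is NOT the continuum limit and NOT the Clay problem.»
HONEST DEPENDENCY: continuum YM on T⁴ ⇐ BetaPertH ∧ nine spine estimates (0/9 proved); BetaPertH ⇐ (D1) ∧ (D4) ∧ CAP+tail;
G-an2-4 gates asym, D1 and NE2/3/4.
ABSOLUTE RULE (cell, verbatim): «No internally-minted statement may enter as a cited fact. Every hypothesis is either kernel-proved in this
package or a verbatim quotation of a PUBLISHED theorem with page reference. The manuscript(s) under audit are NOT citable for their own
disputed steps — they are the thing under adjudication; programme-internal (2001/route/tribunal) claims are never citable.»
NOTHING below is cited: no `[cite: …]`, no `Prop` fact, no `def`.  [folklore] finite-sum ∕ translation bookkeeping over the cell's OWN typed objects BY NAME: an1's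
`AffineAveraging.contourSum ∕ dz ∕ blockSum`, `AveragingContours.shift ∕ blk`, PART 124's `compAvOf ∕ compDefectOf ∕ avSym ∕ lamSym ∕ compLinAvgSymAt ∕ compDefectSymAt` (`_succ ∕ _zero`
clauses), PART 126's `corrPhiOf ∕ corrPsiOf ∕ corrPhiSym ∕ corrPsiSym`, an2 g24's `CompositeCorrectorCovariance.dz_ext_eq_zero_of_blk_eq ∕ blockSum_shift ∕ ext_shift`, an2's
`SymmetrisedAxialPotential.symLinAvgAt_eq_contourSum_sub_dz` and `SymCorrectorForms.SymLamAt_shift ∕ zetaS_shift`.  It asserts nothing about Bałaban's non-linear averages beyond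
their typed linearisations; it values nothing; option L of REFEREE-TABLE-89 is NOT commissioned and its KERNEL level is untouched.

WHY.  The corrector kernel `kerOf Ψ` is `Spr` (translation-invariant in steps of `n = L^m`, finite range) because the form-level corrector is COARSE-TRANSLATION COVARIANT
(`Ψ (shift (n•v) A) = shift (n•v) (Ψ A)`) and local (PART 127): K-U3d's `CompositeCorrectorKernelSpr` consumes exactly `corrPsi_shift ∕ corrPhi_shift`.  This file supplies the
covariance letter for the generic pair and for the (0.4) pair `Ψˢ_m ∕ Φˢ_m`, together with the «intra-block coordinates untouched» letters (the coordinate form of slice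
preservation used by K-U3d's slot files).  With PART 124–128 the (0.4) pair then has BY NAME every form-level letter of K-U3d's five form-level files (`CompositeCorrectorForms ∕
…Linear ∕ …Locality ∕ …Covariance` and the composite `CompositeAveragingCoarseExact`); K-U3d-sym is kernel-level re-instantiation `corrPsi ↦ corrPsiSym` only — UNTYPED before
the referee's word (policy).

WHAT (`d` the lattice dimension; `L` the block side; levels `k`, `i`, `m`; coarse vector `v`; all [folklore]):
§1 GENERIC, NO LETTER: `corrPhiOf_apply_of_blk_eq ∕ corrPsiOf_apply_of_blk_eq` (`blk (L^m) (x + e_α) = blk (L^m) x ⟹ (Φ_m A)_α(x) = A_α(x)`).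
§2 GENERIC from the one-step covariance letters (T) `Av k (shift (L•v) B) = shift v (Av k B)` and (T′) `lam k (shift (L•v) B) = (lam k B) ∘ (· + v)`:
   **`compAvOf_shift`** (`compAvOf k (shift (L^(i+k)•v) A) = shift (L^i•v) (compAvOf k A)`), **`compDefectOf_shift`** (`1 ≤ L`; `ζ_k (shift (L^(i+k)•v) A) = (ζ_k A) ∘ (· + L^i•v)`),
   **`corrPhiOf_shift ∕ corrPsiOf_shift`** (`Φ_m (shift (L^m•v) A) = shift (L^m•v) (Φ_m A)`).
§3 THE (0.4) ONE-STEP LETTERS (any root offsets `ρs : ℕ → Site d`): `contourSum_shift'` (`contourSum N (shift (N•v) A) κ y = contourSum N A κ (y + v)`), `symLinAvgAt_shift'`,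
   `avSym_shift` (= (T)), `lamSym_shift` (= (T′), an2's `zetaS_shift`).
§4 THE (0.4) COMPOSITE: **`compLinAvgSymAt_shift`**, **`compDefectSymAt_shift`**, **`corrPhiSym_shift`**, **`corrPsiSym_shift`**, `corrPhiSym_apply_of_blk_eq ∕ corrPsiSym_apply_of_blk_eq` —
   literally an2 g24's statements with `compLinAvgAt ∕ compDefectAt ∕ corrPhi ∕ corrPsi ↦ compLinAvgSymAt ∕ compDefectSymAt ∕ corrPhiSym ∕ corrPsiSym`.
Namespace: PART 124's `…CompositeAveragingCoarseExactGeneric` is REOPENED on purpose (all names new; the primed one-level letters stay clear of `KernelSpecInstance.contourSum_shift`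
and of any future unprimed letter in `SymmetrisedAxialPotential`).  Provenance: β sub-cell, unit `b2b-balaban-beta-an2` gen 89 (row-D1 OWNER), 2026-08-30; charter-neutral
library typing (no L-root, no (I)-class object).  NOT (C1), NOT (T-ID), NOT D1, NEVER «G-an2-4 closed», NOT `BetaPertH`, NOT continuum, NOT Clay.
-/

namespace Summit.QuantumFields.BalabanUV.Beta.CompositeAveragingCoarseExactGeneric

open Finset
open scoped BigOperators Nat
open Literature.MathematicalPhysics.QuantumFieldTheory.Balaban1983to89.Beta
open AffineAveraging (Site Form0 Form1 box toSite unitVec dz blockSum contourSum)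
open AveragingContours (blk shift)
open Summit.QuantumFields.BalabanUV.Beta.SymmetrisedAxialPotential (SymLamAt symLinAvgAt symLinAvgAt_eq_contourSum_sub_dz)
open Summit.QuantumFields.BalabanUV.Beta.SymCorrectorForms (zetaS SymLamAt_shift zetaS_shift)
open Summit.QuantumFields.BalabanUV.Beta.CompositeCorrectorForms (ext ext_apply)
open Summit.QuantumFields.BalabanUV.Beta.CompositeCorrectorCovariance (dz_ext_eq_zero_of_blk_eq blockSum_shift ext_shift)

noncomputable section

variable {d : ℕ}

/-! ## §1 Generic: the correctors do not touch intra-block coordinates -/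

section Generic

variable (Av : ℕ → Form1 d ℝ → Form1 d ℝ) (lam : ℕ → Form1 d ℝ → Form0 d ℝ) (L : ℕ)

/-- [folklore] **`Φ_m` DOES NOT TOUCH INTRA-BLOCK COORDINATES** (generic scheme): `blk n (x + e_α) = blk n x ⟹ (Φ_m A)_α(x) = A_α(x)`, `n = L^m`. -/
theorem corrPhiOf_apply_of_blk_eq (m : ℕ) (A : Form1 d ℝ) {α : Fin d} {x : Site d} (hx : blk (L ^ m) (x + unitVec α) = blk (L ^ m) x) :
    corrPhiOf Av lam L m A α x = A α x := by
  rw [corrPhiOf, Pi.sub_apply, Pi.sub_apply, Pi.smul_apply, Pi.smul_apply, dz_ext_eq_zero_of_blk_eq _ hx, smul_zero, sub_zero]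

/-- [folklore] **`Ψ_m` DOES NOT TOUCH INTRA-BLOCK COORDINATES** (generic scheme). -/
theorem corrPsiOf_apply_of_blk_eq (m : ℕ) (A : Form1 d ℝ) {α : Fin d} {x : Site d} (hx : blk (L ^ m) (x + unitVec α) = blk (L ^ m) x) :
    corrPsiOf Av lam L m A α x = A α x := by
  rw [corrPsiOf, Pi.add_apply, Pi.add_apply, Pi.smul_apply, Pi.smul_apply, dz_ext_eq_zero_of_blk_eq _ hx, smul_zero, add_zero]

variable {Av lam L}

/-! ## §2 Generic: coarse translation covariance from the one-step letters (T)(T′) -/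

/-- [folklore] **COVARIANCE OF THE GENERIC COMPOSITE** from (T): `compAvOf k (shift (L^(i+k)•v) A) = shift (L^i•v) (compAvOf k A)`. -/
theorem compAvOf_shift (hT : ∀ (k : ℕ) (B : Form1 d ℝ) (v : Site d), Av k (shift ((L : ℤ) • v) B) = shift v (Av k B)) (A : Form1 d ℝ) (v : Site d) :
    ∀ k i : ℕ, compAvOf Av k (shift (((L ^ (i + k) : ℕ) : ℤ) • v) A) = shift (((L ^ i : ℕ) : ℤ) • v) (compAvOf Av k A)
  | 0, i => by simp [compAvOf]
  | k + 1, i => by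
      rw [compAvOf_succ, compAvOf_succ, show i + (k + 1) = (i + 1) + k by ring, compAvOf_shift hT A v k (i + 1), ← hT]
      congr 2
      push_cast
      rw [pow_succ, mul_comm, mul_smul]

/-- [folklore] **COVARIANCE OF THE GENERIC DEFECT POTENTIAL** from (T)(T′) (`1 ≤ L`): `ζ_k (shift (L^(i+k)•v) A) = (ζ_k A) ∘ (· + L^i•v)`. -/
theorem compDefectOf_shift (hL : 1 ≤ L) (hT : ∀ (k : ℕ) (B : Form1 d ℝ) (v : Site d), Av k (shift ((L : ℤ) • v) B) = shift v (Av k B))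
    (hT' : ∀ (k : ℕ) (B : Form1 d ℝ) (v : Site d), lam k (shift ((L : ℤ) • v) B) = fun Y => lam k B (Y + v)) (A : Form1 d ℝ) (v : Site d) :
    ∀ k i : ℕ, compDefectOf Av lam L k (shift (((L ^ (i + k) : ℕ) : ℤ) • v) A) = fun Y => compDefectOf Av lam L k A (Y + (((L ^ i : ℕ) : ℤ) • v))
  | 0, i => by funext Y; simp [compDefectOf]
  | k + 1, i => by
      rw [compDefectOf_succ, compDefectOf_succ, show i + (k + 1) = (i + 1) + k by ring, compDefectOf_shift hL hT hT' A v k (i + 1),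
        compAvOf_shift hT A v k (i + 1)]
      have e : (((L ^ (i + 1) : ℕ) : ℤ) • v) = (L : ℤ) • ((((L ^ i : ℕ) : ℤ)) • v) := by
        push_cast; rw [pow_succ, mul_comm, mul_smul]
      rw [e, hT', blockSum_shift]
      rfl

/-- [folklore] **COARSE TRANSLATION COVARIANCE OF THE GENERIC `Φ_m`** (`1 ≤ L`): `Φ_m (shift (n•v) A) = shift (n•v) (Φ_m A)`, `n = L^m`. -/
theorem corrPhiOf_shift (hL : 1 ≤ L) (hT : ∀ (k : ℕ) (B : Form1 d ℝ) (v : Site d), Av k (shift ((L : ℤ) • v) B) = shift v (Av k B))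
    (hT' : ∀ (k : ℕ) (B : Form1 d ℝ) (v : Site d), lam k (shift ((L : ℤ) • v) B) = fun Y => lam k B (Y + v)) (m : ℕ) (A : Form1 d ℝ) (v : Site d) :
    corrPhiOf Av lam L m (shift (((L ^ m : ℕ) : ℤ) • v) A) = shift (((L ^ m : ℕ) : ℤ) • v) (corrPhiOf Av lam L m A) := by
  have hz := compDefectOf_shift hL hT hT' A v m 0
  rw [zero_add, pow_zero] at hz
  funext α x
  simp only [corrPhiOf, Pi.sub_apply, Pi.smul_apply, shift, dz]
  rw [hz]
  have hn : 1 ≤ L ^ m := Nat.one_le_pow _ _ hL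
  have e1 : ext (L ^ m) (fun Y => compDefectOf Av lam L m A (Y + (((1 : ℕ) : ℤ) • v))) (x + unitVec α)
      = ext (L ^ m) (compDefectOf Av lam L m A) (x + (((L ^ m : ℕ) : ℤ) • v) + unitVec α) := by
    rw [Nat.cast_one, one_smul, add_right_comm, ext_shift hn]
  have e2 : ext (L ^ m) (fun Y => compDefectOf Av lam L m A (Y + (((1 : ℕ) : ℤ) • v))) x
      = ext (L ^ m) (compDefectOf Av lam L m A) (x + (((L ^ m : ℕ) : ℤ) • v)) := by
    rw [Nat.cast_one, one_smul, ext_shift hn]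
  rw [e1, e2]

/-- [folklore] **COARSE TRANSLATION COVARIANCE OF THE GENERIC `Ψ_m`** (`1 ≤ L`). -/
theorem corrPsiOf_shift (hL : 1 ≤ L) (hT : ∀ (k : ℕ) (B : Form1 d ℝ) (v : Site d), Av k (shift ((L : ℤ) • v) B) = shift v (Av k B))
    (hT' : ∀ (k : ℕ) (B : Form1 d ℝ) (v : Site d), lam k (shift ((L : ℤ) • v) B) = fun Y => lam k B (Y + v)) (m : ℕ) (A : Form1 d ℝ) (v : Site d) :
    corrPsiOf Av lam L m (shift (((L ^ m : ℕ) : ℤ) • v) A) = shift (((L ^ m : ℕ) : ℤ) • v) (corrPsiOf Av lam L m A) := by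
  have hz := compDefectOf_shift hL hT hT' A v m 0
  rw [zero_add, pow_zero] at hz
  funext α x
  simp only [corrPsiOf, Pi.add_apply, Pi.smul_apply, shift, dz]
  rw [hz]
  have hn : 1 ≤ L ^ m := Nat.one_le_pow _ _ hL
  have e1 : ext (L ^ m) (fun Y => compDefectOf Av lam L m A (Y + (((1 : ℕ) : ℤ) • v))) (x + unitVec α)
      = ext (L ^ m) (compDefectOf Av lam L m A) (x + (((L ^ m : ℕ) : ℤ) • v) + unitVec α) := by
    rw [Nat.cast_one, one_smul, add_right_comm, ext_shift hn]
  have e2 : ext (L ^ m) (fun Y => compDefectOf Av lam L m A (Y + (((1 : ℕ) : ℤ) • v))) x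
      = ext (L ^ m) (compDefectOf Av lam L m A) (x + (((L ^ m : ℕ) : ℤ) • v)) := by
    rw [Nat.cast_one, one_smul, ext_shift hn]
  rw [e1, e2]

end Generic

/-! ## §3 The (0.4) one-step letters: covariance of `contourSum`, `symLinAvgAt`, `avSym`, `lamSym` -/

/-- [folklore] Coarse translation covariance of the straight block-contour sum: `contourSum N (shift (N•v) A) κ y = contourSum N A κ (y + v)`. -/
theorem contourSum_shift' (N : ℕ) (A : Form1 d ℝ) (v : Site d) (κ : Fin d) (y : Site d) :
    contourSum N (shift ((N : ℤ) • v) A) κ y = contourSum N A κ (y + v) := by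
  simp only [contourSum, shift]
  refine Finset.sum_congr rfl fun b _ => Finset.sum_congr rfl fun s _ => ?_
  congr 1
  rw [smul_add]
  abel

/-- [folklore] **COARSE TRANSLATION COVARIANCE OF THE SYMMETRISED ROOTED LINEAR AVERAGE**: `symLinAvgAt ρ (shift (N•v) A) N μ y = symLinAvgAt ρ A N μ (y + v)` (by the coarse-exact
decomposition, `contourSum_shift'` and an2's `SymLamAt_shift`). -/
theorem symLinAvgAt_shift' (ρ : Site d) (A : Form1 d ℝ) (N : ℕ) (v : Site d) (μ : Fin d) (y : Site d) :
    symLinAvgAt ρ (shift ((N : ℤ) • v) A) N μ y = symLinAvgAt ρ A N μ (y + v) := by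
  have hS : SymLamAt ρ (shift ((N : ℤ) • v) A) N = fun Y => SymLamAt ρ A N (Y + v) := funext fun Y => SymLamAt_shift ρ A N v Y
  rw [symLinAvgAt_eq_contourSum_sub_dz, symLinAvgAt_eq_contourSum_sub_dz, contourSum_shift', hS]
  simp only [dz, add_right_comm y (unitVec μ) v]

/-- [folklore] THE LETTER (T) AT THE SYM DATA: `avSym ρs L k (shift (L•v) B) = shift v (avSym ρs L k B)`. -/
theorem avSym_shift (ρs : ℕ → Site d) (L : ℕ) (k : ℕ) (B : Form1 d ℝ) (v : Site d) :
    avSym ρs L k (shift ((L : ℤ) • v) B) = shift v (avSym ρs L k B) := by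
  funext μ y
  show ((d ! : ℕ) : ℝ)⁻¹ * symLinAvgAt (ρs k) (shift ((L : ℤ) • v) B) L μ y = ((d ! : ℕ) : ℝ)⁻¹ * symLinAvgAt (ρs k) B L μ (y + v)
  rw [symLinAvgAt_shift']

/-- [folklore] THE LETTER (T′) AT THE SYM DATA: `lamSym ρs L k (shift (L•v) B) = (lamSym ρs L k B) ∘ (· + v)` (an2's `zetaS_shift`). -/
theorem lamSym_shift (ρs : ℕ → Site d) (L : ℕ) (k : ℕ) (B : Form1 d ℝ) (v : Site d) :
    lamSym ρs L k (shift ((L : ℤ) • v) B) = fun Y => lamSym ρs L k B (Y + v) := by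
  simp only [lamSym_apply]
  exact zetaS_shift _ _ _ _

/-! ## §4 The (0.4) composite: covariance of `compLinAvgSymAt`, `compDefectSymAt`, `corrPhiSym`, `corrPsiSym`; intra-block coordinates -/

section Sym

variable (ρs : ℕ → Site d) (L : ℕ)

/-- [folklore] **COVARIANCE OF THE (0.4) COMPOSITE**: `compLinAvgSymAt k (shift (L^(i+k)•v) A) = shift (L^i•v) (compLinAvgSymAt k A)`. -/
theorem compLinAvgSymAt_shift (A : Form1 d ℝ) (v : Site d) (k i : ℕ) :
    compLinAvgSymAt ρs L k (shift (((L ^ (i + k) : ℕ) : ℤ) • v) A) = shift (((L ^ i : ℕ) : ℤ) • v) (compLinAvgSymAt ρs L k A) :=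
  compAvOf_shift (avSym_shift ρs L) A v k i

/-- [folklore] **COVARIANCE OF THE (0.4) DEFECT POTENTIAL** (`1 ≤ L`): `ζˢ_k (shift (L^(i+k)•v) A) = (ζˢ_k A) ∘ (· + L^i•v)`. -/
theorem compDefectSymAt_shift {L : ℕ} (hL : 1 ≤ L) (A : Form1 d ℝ) (v : Site d) (k i : ℕ) :
    compDefectSymAt ρs L k (shift (((L ^ (i + k) : ℕ) : ℤ) • v) A) = fun Y => compDefectSymAt ρs L k A (Y + (((L ^ i : ℕ) : ℤ) • v)) :=
  compDefectOf_shift hL (avSym_shift ρs L) (lamSym_shift ρs L) A v k i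

variable (r : ℕ → (Fin d → ℕ))

/-- [folklore] **COARSE TRANSLATION COVARIANCE OF `Φˢ_m`** (`1 ≤ L`): `Φˢ_m (shift (n•v) A) = shift (n•v) (Φˢ_m A)`, `n = L^m`. -/
theorem corrPhiSym_shift {L : ℕ} (hL : 1 ≤ L) (m : ℕ) (A : Form1 d ℝ) (v : Site d) :
    corrPhiSym r L m (shift (((L ^ m : ℕ) : ℤ) • v) A) = shift (((L ^ m : ℕ) : ℤ) • v) (corrPhiSym r L m A) :=
  corrPhiOf_shift hL (avSym_shift _ L) (lamSym_shift _ L) m A v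

/-- [folklore] **COARSE TRANSLATION COVARIANCE OF `Ψˢ_m`** (`1 ≤ L`). -/
theorem corrPsiSym_shift {L : ℕ} (hL : 1 ≤ L) (m : ℕ) (A : Form1 d ℝ) (v : Site d) :
    corrPsiSym r L m (shift (((L ^ m : ℕ) : ℤ) • v) A) = shift (((L ^ m : ℕ) : ℤ) • v) (corrPsiSym r L m A) :=
  corrPsiOf_shift hL (avSym_shift _ L) (lamSym_shift _ L) m A v

/-- [folklore] **`Φˢ_m` DOES NOT TOUCH INTRA-BLOCK COORDINATES.** -/
theorem corrPhiSym_apply_of_blk_eq (m : ℕ) (A : Form1 d ℝ) {α : Fin d} {x : Site d} (hx : blk (L ^ m) (x + unitVec α) = blk (L ^ m) x) :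
    corrPhiSym r L m A α x = A α x :=
  corrPhiOf_apply_of_blk_eq _ _ L m A hx

/-- [folklore] **`Ψˢ_m` DOES NOT TOUCH INTRA-BLOCK COORDINATES.** -/
theorem corrPsiSym_apply_of_blk_eq (m : ℕ) (A : Form1 d ℝ) {α : Fin d} {x : Site d} (hx : blk (L ^ m) (x + unitVec α) = blk (L ^ m) x) :
    corrPsiSym r L m A α x = A α x :=
  corrPsiOf_apply_of_blk_eq _ _ L m A hx

end Sym

end

end Summit.QuantumFields.BalabanUV.Beta.CompositeAveragingCoarseExactGeneric
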